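import Summits.AnomalousDissipation.AnomalousDissipation.Theorems.SolenoidalFractalHomogenisationRealisedQuasiStaticCellLawSlavedPairSectorSlot
import Summits.AnomalousDissipation.AnomalousDissipation.Theorems.SolenoidalFractalHomogenisationRealisedQuasiStaticCellLawSlavedSectorDecay
import HarnessLib

/-!
# K2R `RealisedQuasiStaticCellLaw`, line `floquet-bloch`, stub `stub_lowSectorDecay` (S1D): exponential decay of the
# truncation energy of a weakly coupled low sector at an ISOTROPIC target rate, uniformly in `N` (W-near regime)

Summits-side helper file (everything proved; no definitions, no named facts; `--supports stmt-AnomalousDissipation-20446`).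
Counterpart of `slavedSector_exp_decay` (`…SlavedSectorDecay`, min-polarisation rate): the in-period functionals are the
isotropic-pair sector functionals `Φ_{q,j}` of `pairSector_slot_contraction` (joint slow form with weights
`a_{q,j}, b_{q,j}, c_{q,j}` on slot `j` of period `q`, transported at the nominal slaved rates relative to a constant target
rate `λ̄`). Hypotheses beyond the per-slot data: JUNCTIONS (at the start of slot `j+1` the form of slot `j+1` is below the
form of slot `j` on vectors `⊥ ℓ`), START (at `qP` the form of slot `0` is `≤ |u|²`) and END (at `(q+1)P` the form of the
last slot is `≥ |u|²` — the metric reset, in the application a consequence of the near-commuting product estimate and the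
isotropy of the word). Then the weighted sector energy `Ψ_β` contracts by `∏_j Θ_j` over every period,
`Θ_j = max(θ_F, exp(−2(1−ε)λ̄τ_j + slack_j/G_min))`, and `E_N(t) ≤ β(∏Θ)⁻¹exp(−(log(∏Θ)⁻¹/P)t)E_N(0)` (`isoSector_exp_decay`).
-/

set_option linter.dupNamespace false

noncomputable section

namespace Summit.AnomalousDissipation.AnomalousDissipation.Theorems.SolenoidalFractalHomogenisation.RealisedQuasiStaticCellLaw

open Set MeasureTheory Filter Topology Function Complex Matrix
open scoped InnerProductSpace ComplexConjugate Matrix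
open Literature.Analysis Literature.Analysis.FunctionSpaces Literature.Analysis.FunctionSpaces.Torus
open Literature.Analysis.FluidPDE Literature.Analysis.FluidPDE.LatticeShear
open Summit.AnomalousDissipation.AnomalousDissipation.Theorems.SolenoidalFractalHomogenisation.PermissibleCarrier

variable {k₀ : ℕ}

/-- **Exponential decay of the truncation energy of a weakly coupled low sector at an isotropic target rate,
uniformly in `N`.** See the module docstring. -/
theorem isoSector_exp_decay (W : LatticeWord k₀) {n : ℕ} (hn : 0 < n) {κ : ℝ} (hκ : 0 < κ)
    (ℓ : Fin 3 → ℤ) (hℓn : 2 * ‖latticeVec ℓ‖ ≤ n) {w₀ : UnitAddTorus (Fin 3) → EuclideanSpace ℝ (Fin 3)}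
    (hw₀ : FunctionSpaces.Torus.MemSobolev 1 (FunctionSpaces.EuclideanSpace.complexify ∘ w₀))
    (hdiv : FunctionSpaces.Torus.IsWeaklyDivFree w₀) (hmean : FunctionSpaces.Torus.HasZeroMean w₀)
    (hsupp : ∀ k : Fin 3 → ℤ, ¬ ((∃ z : Fin 3 → ℤ, k = ℓ + (n:ℤ) • z) ∨ (∃ z : Fin 3 → ℤ, k = -ℓ + (n:ℤ) • z)) →
      UnitAddTorus.mFourierCoeff (FunctionSpaces.EuclideanSpace.complexify ∘ w₀) k = 0)
    {N : ℕ} (hBN : (Finset.univ.biUnion fun j : Fin k₀ =>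
        ({(fun i => (W.phase j).m i * n), -(fun i => (W.phase j).m i * n)} : Finset (Fin 3 → ℤ))) ⊆ freqBall N)
    (hk : ∀ j : Fin k₀, ∀ J : ℤ, ℓ + J • (fun i => (W.phase j).m i * (n : ℤ)) ∈ freqBall N →
      ℓ + J • (fun i => (W.phase j).m i * (n : ℤ)) ≠ 0)
    (hdisj : ∀ j : Fin k₀, ∀ J J' : ℤ,
      ℓ + J • (fun i => (W.phase j).m i * (n : ℤ)) ≠ -(ℓ + J' • (fun i => (W.phase j).m i * (n : ℤ))))
    (ζr : Fin k₀ → Fin 3 → ℝ) (hζ1 : ∀ j, ζr j ⬝ᵥ ζr j = 1) (hζ0 : ∀ j, ζr j ⬝ᵥ (fun i => ((ℓ i : ℤ) : ℝ)) = 0)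
    (hζK : ∀ j, ζr j ⬝ᵥ (fun i => (((fun i => (W.phase j).m i * (n : ℤ)) i : ℤ) : ℝ)) = 0)
    (pf : Fin k₀ → ℤ → Fin 3 → ℝ)
    (hp : ∀ j, ∀ J : ℤ, pf j J = (Real.sqrt ((fun i => (((ℓ + J • (fun i => (W.phase j).m i * (n : ℤ))) i : ℤ) : ℝ)) ⬝ᵥ
        (fun i => (((ℓ + J • (fun i => (W.phase j).m i * (n : ℤ))) i : ℤ) : ℝ))))⁻¹ •
        (fun i => (((ℓ + J • (fun i => (W.phase j).m i * (n : ℤ))) i : ℤ) : ℝ)) ⨯₃ ζr j)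
    (Wset : Fin k₀ → Finset ℤ)
    (hW : ∀ j, ∀ J : ℤ, J ∈ Wset j ↔ ℓ + J • (fun i => (W.phase j).m i * (n : ℤ)) ∈ freqBall N)
    (h0 : ∀ j, (0 : ℤ) ∈ Wset j) (h1 : ∀ j, (1 : ℤ) ∈ Wset j) (hm1 : ∀ j, (-1 : ℤ) ∈ Wset j)
    (hs : ∀ j, ∀ J ∈ Wset j, |pf j J ⬝ᵥ pf j (J + 1)| ≤ 1)
    (Λ σo σi σ g₁ Θ : Fin k₀ → ℝ) (Δ ε β lam Gmax Gmin : ℝ)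
    (wa wb : ℕ → Fin k₀ → ℝ → ℝ) (wc : ℕ → Fin k₀ → ℝ → ℂ)
    (hΛ : ∀ j, Λ j = κ * (4 * Real.pi ^ 2 * freqNormSq (fun i => (W.phase j).m i * (n : ℤ))))
    (hΔ0 : 0 < Δ) (hε : 0 ≤ ε) (hβ : 1 ≤ β) (hlam : 0 ≤ lam) (hGmin : 0 < Gmin)
    (hgap : ∀ j, ∀ J ∈ Wset j, J ≠ 0 →
      freqNormSq ℓ / freqNormSq (fun i => (W.phase j).m i * (n : ℤ)) + Δ ≤
        freqNormSq (ℓ + J • (fun i => (W.phase j).m i * (n : ℤ))) / freqNormSq (fun i => (W.phase j).m i * (n : ℤ)))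
    (hσo : ∀ j, σo j = 1 / (freqNormSq (ℓ + (-1 : ℤ) • (fun i => (W.phase j).m i * (n : ℤ))) /
          freqNormSq (fun i => (W.phase j).m i * (n : ℤ)) - freqNormSq ℓ / freqNormSq (fun i => (W.phase j).m i * (n : ℤ))) +
        1 / (freqNormSq (ℓ + (1 : ℤ) • (fun i => (W.phase j).m i * (n : ℤ))) /
          freqNormSq (fun i => (W.phase j).m i * (n : ℤ)) - freqNormSq ℓ / freqNormSq (fun i => (W.phase j).m i * (n : ℤ))))
    (hσi : ∀ j, σi j = (pf j (-1) ⬝ᵥ pf j 0) ^ 2 / (freqNormSq (ℓ + (-1 : ℤ) • (fun i => (W.phase j).m i * (n : ℤ))) /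
          freqNormSq (fun i => (W.phase j).m i * (n : ℤ)) - freqNormSq ℓ / freqNormSq (fun i => (W.phase j).m i * (n : ℤ))) +
        (pf j 0 ⬝ᵥ pf j 1) ^ 2 / (freqNormSq (ℓ + (1 : ℤ) • (fun i => (W.phase j).m i * (n : ℤ))) /
          freqNormSq (fun i => (W.phase j).m i * (n : ℤ)) - freqNormSq ℓ / freqNormSq (fun i => (W.phase j).m i * (n : ℤ))))
    (hg₁ : ∀ j, g₁ j = 2 * Real.pi * (∑ i, (W.phase j).e i * (ℓ i : ℝ)) *
        ‖Complex.exp ((W.phase j).φ * Complex.I) *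
          (1 / (2 * ((2 * Real.pi * ‖latticeVec (W.phase j).m‖ : ℝ) : ℂ) * Complex.I))‖ * (1 / (n : ℝ)) / Λ j)
    (hσole : ∀ j, σo j ≤ σ j) (hσile : ∀ j, σi j ≤ σ j)
    (hGmax : ∀ q : ℕ, ∀ j, ∀ t ∈ Icc ((q : ℝ) * W.period + W.start j) ((q : ℝ) * W.period + W.start j + (W.phase j).τ), wa q j t ≤ Gmax ∧ wb q j t ≤ Gmax ∧ ‖wc q j t‖ ≤ Gmax)
    (hG : ∀ q : ℕ, ∀ j, ∀ t ∈ Icc ((q : ℝ) * W.period + W.start j) ((q : ℝ) * W.period + W.start j + (W.phase j).τ), ∀ y₁ y₂ : ℂ,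
      Gmin * (‖y₁‖ ^ 2 + ‖y₂‖ ^ 2) ≤ wa q j t * ‖y₁‖ ^ 2 + wb q j t * ‖y₂‖ ^ 2 + 2 * (wc q j t * conj y₁ * y₂).re)
    (hβ' : ∀ j, 16 * Gmax ^ 2 * g₁ j ^ 2 * Λ j * 2 ≤ Gmin * ε * lam * β * Δ)
    (hsmall : ∀ j, g₁ j ^ 2 * (4 * 2 / Δ) + 2 * lam / Λ j ≤ Δ)
    (hwa : ∀ q : ℕ, ∀ j, ∀ t ∈ Icc ((q : ℝ) * W.period + W.start j) ((q : ℝ) * W.period + W.start j + (W.phase j).τ),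
      HasDerivWithinAt (wa q j) ((2 * (Λ j * (freqNormSq ℓ / freqNormSq (fun i => (W.phase j).m i * (n : ℤ)) +
          (g₁ j * LatticeWord.trapezoid 0 (W.phase j).τ W.ramp (t - ((q : ℝ) * W.period + W.start j))) ^ 2 * σo j) - lam)) *
        wa q j t) (Icc ((q : ℝ) * W.period + W.start j) ((q : ℝ) * W.period + W.start j + (W.phase j).τ)) t)
    (hwb : ∀ q : ℕ, ∀ j, ∀ t ∈ Icc ((q : ℝ) * W.period + W.start j) ((q : ℝ) * W.period + W.start j + (W.phase j).τ),
      HasDerivWithinAt (wb q j) ((2 * (Λ j * (freqNormSq ℓ / freqNormSq (fun i => (W.phase j).m i * (n : ℤ)) +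
          (g₁ j * LatticeWord.trapezoid 0 (W.phase j).τ W.ramp (t - ((q : ℝ) * W.period + W.start j))) ^ 2 * σi j) - lam)) *
        wb q j t) (Icc ((q : ℝ) * W.period + W.start j) ((q : ℝ) * W.period + W.start j + (W.phase j).τ)) t)
    (hwc : ∀ q : ℕ, ∀ j, ∀ t ∈ Icc ((q : ℝ) * W.period + W.start j) ((q : ℝ) * W.period + W.start j + (W.phase j).τ),
      HasDerivWithinAt (wc q j) ((((Λ j * (freqNormSq ℓ / freqNormSq (fun i => (W.phase j).m i * (n : ℤ)) +
            (g₁ j * LatticeWord.trapezoid 0 (W.phase j).τ W.ramp (t - ((q : ℝ) * W.period + W.start j))) ^ 2 * σo j) +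
          Λ j * (freqNormSq ℓ / freqNormSq (fun i => (W.phase j).m i * (n : ℤ)) +
            (g₁ j * LatticeWord.trapezoid 0 (W.phase j).τ W.ramp (t - ((q : ℝ) * W.period + W.start j))) ^ 2 * σi j) -
          2 * lam : ℝ) : ℂ) * wc q j t))
        (Icc ((q : ℝ) * W.period + W.start j) ((q : ℝ) * W.period + W.start j + (W.phase j).τ)) t)
    (hjunc : ∀ q : ℕ, ∀ j : Fin k₀, ∀ hj : j.val + 1 < k₀, ∀ u : EuclideanSpace ℂ (Fin 3),
      (fun i => ((ℓ i : ℤ) : ℂ)) ⬝ᵥ WithLp.ofLp u = 0 →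
        wa q ⟨j.val + 1, hj⟩ ((q : ℝ) * W.period + W.start ⟨j.val + 1, hj⟩) * ‖inner ℂ (WithLp.toLp 2 (Complex.ofReal ∘ ζr ⟨j.val + 1, hj⟩) : EuclideanSpace ℂ (Fin 3)) u‖ ^ 2 +
          wb q ⟨j.val + 1, hj⟩ ((q : ℝ) * W.period + W.start ⟨j.val + 1, hj⟩) * ‖inner ℂ (WithLp.toLp 2 (Complex.ofReal ∘ pf ⟨j.val + 1, hj⟩ 0) : EuclideanSpace ℂ (Fin 3)) u‖ ^ 2 +
          2 * (wc q ⟨j.val + 1, hj⟩ ((q : ℝ) * W.period + W.start ⟨j.val + 1, hj⟩) * conj (inner ℂ (WithLp.toLp 2 (Complex.ofReal ∘ ζr ⟨j.val + 1, hj⟩) : EuclideanSpace ℂ (Fin 3)) u) * inner ℂ (WithLp.toLp 2 (Complex.ofReal ∘ pf ⟨j.val + 1, hj⟩ 0) : EuclideanSpace ℂ (Fin 3)) u).re ≤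
        wa q j ((q : ℝ) * W.period + W.start j + (W.phase j).τ) * ‖inner ℂ (WithLp.toLp 2 (Complex.ofReal ∘ ζr j) : EuclideanSpace ℂ (Fin 3)) u‖ ^ 2 +
          wb q j ((q : ℝ) * W.period + W.start j + (W.phase j).τ) * ‖inner ℂ (WithLp.toLp 2 (Complex.ofReal ∘ pf j 0) : EuclideanSpace ℂ (Fin 3)) u‖ ^ 2 +
          2 * (wc q j ((q : ℝ) * W.period + W.start j + (W.phase j).τ) * conj (inner ℂ (WithLp.toLp 2 (Complex.ofReal ∘ ζr j) : EuclideanSpace ℂ (Fin 3)) u) * inner ℂ (WithLp.toLp 2 (Complex.ofReal ∘ pf j 0) : EuclideanSpace ℂ (Fin 3)) u).re)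
    (hstart : ∀ q : ℕ, ∀ u : EuclideanSpace ℂ (Fin 3), (fun i => ((ℓ i : ℤ) : ℂ)) ⬝ᵥ WithLp.ofLp u = 0 →
        wa q ⟨0, W.pos⟩ ((q : ℝ) * W.period + W.start ⟨0, W.pos⟩) * ‖inner ℂ (WithLp.toLp 2 (Complex.ofReal ∘ ζr ⟨0, W.pos⟩) : EuclideanSpace ℂ (Fin 3)) u‖ ^ 2 +
          wb q ⟨0, W.pos⟩ ((q : ℝ) * W.period + W.start ⟨0, W.pos⟩) * ‖inner ℂ (WithLp.toLp 2 (Complex.ofReal ∘ pf ⟨0, W.pos⟩ 0) : EuclideanSpace ℂ (Fin 3)) u‖ ^ 2 +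
          2 * (wc q ⟨0, W.pos⟩ ((q : ℝ) * W.period + W.start ⟨0, W.pos⟩) * conj (inner ℂ (WithLp.toLp 2 (Complex.ofReal ∘ ζr ⟨0, W.pos⟩) : EuclideanSpace ℂ (Fin 3)) u) * inner ℂ (WithLp.toLp 2 (Complex.ofReal ∘ pf ⟨0, W.pos⟩ 0) : EuclideanSpace ℂ (Fin 3)) u).re ≤ ‖u‖ ^ 2)
    (hend : ∀ q : ℕ, ∀ u : EuclideanSpace ℂ (Fin 3), (fun i => ((ℓ i : ℤ) : ℂ)) ⬝ᵥ WithLp.ofLp u = 0 →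
        ‖u‖ ^ 2 ≤ wa q ⟨k₀ - 1, Nat.sub_lt W.pos one_pos⟩ ((q : ℝ) * W.period + W.start ⟨k₀ - 1, Nat.sub_lt W.pos one_pos⟩ + (W.phase ⟨k₀ - 1, Nat.sub_lt W.pos one_pos⟩).τ) * ‖inner ℂ (WithLp.toLp 2 (Complex.ofReal ∘ ζr ⟨k₀ - 1, Nat.sub_lt W.pos one_pos⟩) : EuclideanSpace ℂ (Fin 3)) u‖ ^ 2 +
          wb q ⟨k₀ - 1, Nat.sub_lt W.pos one_pos⟩ ((q : ℝ) * W.period + W.start ⟨k₀ - 1, Nat.sub_lt W.pos one_pos⟩ + (W.phase ⟨k₀ - 1, Nat.sub_lt W.pos one_pos⟩).τ) * ‖inner ℂ (WithLp.toLp 2 (Complex.ofReal ∘ pf ⟨k₀ - 1, Nat.sub_lt W.pos one_pos⟩ 0) : EuclideanSpace ℂ (Fin 3)) u‖ ^ 2 +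
          2 * (wc q ⟨k₀ - 1, Nat.sub_lt W.pos one_pos⟩ ((q : ℝ) * W.period + W.start ⟨k₀ - 1, Nat.sub_lt W.pos one_pos⟩ + (W.phase ⟨k₀ - 1, Nat.sub_lt W.pos one_pos⟩).τ) * conj (inner ℂ (WithLp.toLp 2 (Complex.ofReal ∘ ζr ⟨k₀ - 1, Nat.sub_lt W.pos one_pos⟩) : EuclideanSpace ℂ (Fin 3)) u) * inner ℂ (WithLp.toLp 2 (Complex.ofReal ∘ pf ⟨k₀ - 1, Nat.sub_lt W.pos one_pos⟩ 0) : EuclideanSpace ℂ (Fin 3)) u).re)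
    (hΘ : ∀ j, max (Real.exp (-(8 * Real.pi ^ 2 * κ * ((n : ℝ) / 2) ^ 2) * (W.phase j).τ))
        (Real.exp (-(2 * (1 - ε) * lam * (W.phase j).τ) +
          (40 * β * 2 * Λ j * (W.phase j).τ * g₁ j ^ 4 * (1 + g₁ j ^ 2 * σ j ^ 2) / Δ ^ 3 +
            48 * β * 2 * g₁ j ^ 2 / (W.ramp * (W.phase j).τ * Λ j * Δ ^ 3)) / Gmin)) ≤ Θ j)
    (hΘ1 : ∏ j, Θ j ≤ 1) (hΘ0 : 0 < ∏ j, Θ j) {t : ℝ} (ht : 0 ≤ t) :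
    ∑ k ∈ freqBall N, ‖(pvSetup_cell W hn hκ.le ℓ hw₀ hdiv hmean hsupp).galerkinCoeffAt N t k‖ ^ 2 ≤
      β * (∏ j, Θ j)⁻¹ * Real.exp (-(Real.log (∏ j, Θ j)⁻¹ / W.period) * t) *
        ∑ k ∈ freqBall N, ‖(pvSetup_cell W hn hκ.le ℓ hw₀ hdiv hmean hsupp).galerkinCoeffAt N 0 k‖ ^ 2 := by
  classical
  set hPV := pvSetup_cell W hn hκ.le ℓ hw₀ hdiv hmean hsupp with hPVdef
  have hP := period_pos W
  have hβ0 : 0 ≤ β := zero_le_one.trans hβ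
  obtain ⟨E, hE⟩ : ∃ E : ℝ → ℝ, E = fun τ => ∑ k ∈ freqBall N, ‖hPV.galerkinCoeffAt N τ k‖ ^ 2 := ⟨_, rfl⟩
  obtain ⟨Ψ, hΨ⟩ : ∃ Ψ : ℝ → ℝ, Ψ = fun τ => β * ∑ k ∈ freqBall N, ‖hPV.galerkinCoeffAt N τ k‖ ^ 2 -
      (β - 1) * (‖hPV.galerkinCoeffAt N τ ℓ‖ ^ 2 + ‖hPV.galerkinCoeffAt N τ (-ℓ)‖ ^ 2) := ⟨_, rfl⟩
  obtain ⟨Sq, hSq⟩ : ∃ Sq : ℕ → Fin k₀ → ℝ → EuclideanSpace ℂ (Fin 3) → ℝ, Sq = fun q j τ u =>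
      wa q j τ * ‖inner ℂ (WithLp.toLp 2 (Complex.ofReal ∘ ζr j) : EuclideanSpace ℂ (Fin 3)) u‖ ^ 2 +
        wb q j τ * ‖inner ℂ (WithLp.toLp 2 (Complex.ofReal ∘ pf j 0) : EuclideanSpace ℂ (Fin 3)) u‖ ^ 2 +
        2 * (wc q j τ * conj (inner ℂ (WithLp.toLp 2 (Complex.ofReal ∘ ζr j) : EuclideanSpace ℂ (Fin 3)) u) *
          inner ℂ (WithLp.toLp 2 (Complex.ofReal ∘ pf j 0) : EuclideanSpace ℂ (Fin 3)) u).re := ⟨_, rfl⟩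
  obtain ⟨Φ, hΦ⟩ : ∃ Φ : ℕ → Fin k₀ → ℝ → ℝ, Φ = fun q j τ =>
      β * ∑ k ∈ freqBall N, ‖hPV.galerkinCoeffAt N τ k‖ ^ 2 - 2 * β * ‖hPV.galerkinCoeffAt N τ ℓ‖ ^ 2 +
        2 * Sq q j τ (hPV.galerkinCoeffAt N τ ℓ) := ⟨_, rfl⟩
  have hEnn : ∀ τ, 0 ≤ E τ := fun τ => by rw [hE]; exact Finset.sum_nonneg fun k _ => by positivity
  -- `E ≤ Ψ ≤ βE`: the slow pair `±ℓ` lies in the ball and is distinct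
  have j0 : Fin k₀ := ⟨0, W.pos⟩
  have hℓS : ℓ ∈ freqBall N := by
    have := (hW j0 0).1 (h0 j0); simpa using this
  have hℓS' : -ℓ ∈ freqBall N := neg_mem_freqBall_of_mem _ hℓS
  have hℓne : ℓ ≠ -ℓ := by
    have := hdisj j0 0 0; simpa using this
  have hpair : ∀ τ, ‖hPV.galerkinCoeffAt N τ ℓ‖ ^ 2 + ‖hPV.galerkinCoeffAt N τ (-ℓ)‖ ^ 2 ≤ E τ := by
    intro τ
    rw [hE]
    have hsub : ({ℓ, -ℓ} : Finset (Fin 3 → ℤ)) ⊆ freqBall N := by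
      intro k hk'
      simp only [Finset.mem_insert, Finset.mem_singleton] at hk'
      rcases hk' with rfl | rfl
      · exact hℓS
      · exact hℓS'
    have := Finset.sum_le_sum_of_subset_of_nonneg hsub (fun k _ _ => sq_nonneg ‖hPV.galerkinCoeffAt N τ k‖)
    rw [Finset.sum_pair hℓne] at this
    exact this
  have hEΨ : ∀ τ, E τ ≤ Ψ τ := by
    intro τ
    have h := hpair τ
    rw [hΨ]; rw [hE] at h ⊢
    nlinarith [h, hβ]
  have hΨ0 : Ψ 0 ≤ β * E 0 := by
    rw [hΨ, hE]
    have : 0 ≤ ‖hPV.galerkinCoeffAt N 0 ℓ‖ ^ 2 + ‖hPV.galerkinCoeffAt N 0 (-ℓ)‖ ^ 2 := by positivity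
    nlinarith [this, hβ]
  -- `Ψ` versus the in-period functionals `Φ q j`
  have hneg : ∀ τ, ‖hPV.galerkinCoeffAt N τ (-ℓ)‖ ^ 2 = ‖hPV.galerkinCoeffAt N τ ℓ‖ ^ 2 := fun τ => by
    rw [norm_galerkinCoeffAt_neg W hn hκ.le ℓ hw₀ hdiv hmean hsupp]
  have hΨ' : ∀ τ, Ψ τ = β * ∑ k ∈ freqBall N, ‖hPV.galerkinCoeffAt N τ k‖ ^ 2 - 2 * β * ‖hPV.galerkinCoeffAt N τ ℓ‖ ^ 2 +
      2 * ‖hPV.galerkinCoeffAt N τ ℓ‖ ^ 2 := by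
    intro τ; rw [hΨ]; simp only [hneg τ]; ring
  have htrans : ∀ τ, (fun i => ((ℓ i : ℤ) : ℂ)) ⬝ᵥ WithLp.ofLp (hPV.galerkinCoeffAt N τ ℓ) = 0 := by
    intro τ; rw [dotProduct]; exact hPV.sum_mul_galerkinCoeffAt N τ ℓ
  have hΦstart : ∀ q : ℕ, Φ q ⟨0, W.pos⟩ ((q : ℝ) * W.period + W.start ⟨0, W.pos⟩) ≤ Ψ ((q : ℝ) * W.period) := by
    intro q
    have hst0 : W.start ⟨0, W.pos⟩ = 0 := by rw [start_eq_sum_range W 0 W.pos]; simp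
    have h := hstart q (hPV.galerkinCoeffAt N ((q : ℝ) * W.period + W.start ⟨0, W.pos⟩) ℓ) (htrans _)
    rw [hΦ, hSq, hΨ']
    simp only [hst0, add_zero] at h ⊢
    linarith only [h]
  have hΦend : ∀ q : ℕ, Ψ ((q : ℝ) * W.period + W.start ⟨k₀ - 1, Nat.sub_lt W.pos one_pos⟩ +
        (W.phase ⟨k₀ - 1, Nat.sub_lt W.pos one_pos⟩).τ) ≤
      Φ q ⟨k₀ - 1, Nat.sub_lt W.pos one_pos⟩ ((q : ℝ) * W.period + W.start ⟨k₀ - 1, Nat.sub_lt W.pos one_pos⟩ +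
        (W.phase ⟨k₀ - 1, Nat.sub_lt W.pos one_pos⟩).τ) := by
    intro q
    have h := hend q (hPV.galerkinCoeffAt N ((q : ℝ) * W.period + W.start ⟨k₀ - 1, Nat.sub_lt W.pos one_pos⟩ +
        (W.phase ⟨k₀ - 1, Nat.sub_lt W.pos one_pos⟩).τ) ℓ) (htrans _)
    rw [hΦ, hSq, hΨ']
    simp only at h ⊢
    linarith only [h]
  have hΦjunc : ∀ q : ℕ, ∀ m : ℕ, ∀ hm' : m < k₀, ∀ hm : m + 1 < k₀,
      Φ q ⟨m + 1, hm⟩ ((q : ℝ) * W.period + W.start ⟨m + 1, hm⟩) ≤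
        Φ q ⟨m, hm'⟩ ((q : ℝ) * W.period + W.start ⟨m, hm'⟩ + (W.phase ⟨m, hm'⟩).τ) := by
    intro q m hm' hm
    have hst : W.start ⟨m + 1, hm⟩ = W.start ⟨m, hm'⟩ + (W.phase ⟨m, hm'⟩).τ := by
      rw [start_eq_sum_range W (m + 1) hm, start_eq_sum_range W m hm', Finset.sum_range_succ, dif_pos hm']
    have h := hjunc q ⟨m, hm'⟩ hm (hPV.galerkinCoeffAt N ((q : ℝ) * W.period + W.start ⟨m + 1, hm⟩) ℓ) (htrans _)
    rw [hΦ, hSq]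
    simp only [hst, ← add_assoc] at h ⊢
    linarith only [h]
  -- one slot of one period
  have hslot : ∀ q : ℕ, ∀ j : Fin k₀,
      Φ q j ((q : ℝ) * W.period + W.start j + (W.phase j).τ) ≤ Θ j * Φ q j ((q : ℝ) * W.period + W.start j) := by
    intro q j
    have h := pairSector_slot_contraction W hn hκ ℓ hℓn hw₀ hdiv hmean hsupp hBN q j le_rfl (hk j) (hdisj j) (hζ1 j)
      (hζ0 j) (hζK j) (hp j) (hW j) (h0 j) (h1 j) (hm1 j) (hs j) (Λ j) Δ ε β (σo j) (σi j) (σ j) lam Gmax Gmin (g₁ j)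
      (wa q j) (wb q j) (wc q j) (hΛ j) hΔ0 hε hβ0 hlam hGmin (hgap j) (hσo j) (hσi j) (hg₁ j) (hσole j) (hσile j)
      (hGmax q j) (hG q j) (hβ' j) (hsmall j) (hwa q j) (hwb q j) (hwc q j) (Θ j) (hΘ j)
    simp only [hΦ, hSq]
    convert h using 3
  -- chaining the slots of one period
  have hΘnn : ∀ j, 0 ≤ Θ j := fun j => le_trans (le_trans (Real.exp_pos _).le (le_max_left _ _)) (hΘ j)
  have hchain : ∀ q : ℕ, ∀ m : ℕ, ∀ hm : m < k₀,
      Φ q ⟨m, hm⟩ ((q : ℝ) * W.period + W.start ⟨m, hm⟩ + (W.phase ⟨m, hm⟩).τ) ≤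
        (∏ i ∈ Finset.range (m + 1), (if h : i < k₀ then Θ ⟨i, h⟩ else 1)) * Ψ ((q : ℝ) * W.period) := by
    intro q m
    induction m with
    | zero =>
      intro hm
      rw [Finset.prod_range_one, dif_pos hm]
      exact (hslot q ⟨0, hm⟩).trans (mul_le_mul_of_nonneg_left (hΦstart q) (hΘnn _))
    | succ m ih =>
      intro hm
      have hm' : m < k₀ := Nat.lt_of_succ_lt hm
      rw [Finset.prod_range_succ, dif_pos hm]
      calc Φ q ⟨m + 1, hm⟩ ((q : ℝ) * W.period + W.start ⟨m + 1, hm⟩ + (W.phase ⟨m + 1, hm⟩).τ)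
          ≤ Θ ⟨m + 1, hm⟩ * Φ q ⟨m + 1, hm⟩ ((q : ℝ) * W.period + W.start ⟨m + 1, hm⟩) := hslot q ⟨m + 1, hm⟩
        _ ≤ Θ ⟨m + 1, hm⟩ * Φ q ⟨m, hm'⟩ ((q : ℝ) * W.period + W.start ⟨m, hm'⟩ + (W.phase ⟨m, hm'⟩).τ) :=
            mul_le_mul_of_nonneg_left (hΦjunc q m hm' hm) (hΘnn _)
        _ ≤ Θ ⟨m + 1, hm⟩ * ((∏ i ∈ Finset.range (m + 1), (if h : i < k₀ then Θ ⟨i, h⟩ else 1)) *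
              Ψ ((q : ℝ) * W.period)) := mul_le_mul_of_nonneg_left (ih hm') (hΘnn _)
        _ = (∏ i ∈ Finset.range (m + 1), (if h : i < k₀ then Θ ⟨i, h⟩ else 1)) * Θ ⟨m + 1, hm⟩ *
              Ψ ((q : ℝ) * W.period) := by ring
  have hprod : ∏ i ∈ Finset.range k₀, (if h : i < k₀ then Θ ⟨i, h⟩ else 1) = ∏ j, Θ j := by
    rw [← Fin.prod_univ_eq_prod_range (fun i' : ℕ => if h : i' < k₀ then Θ ⟨i', h⟩ else 1) k₀]
    refine Finset.prod_congr rfl fun i _ => ?_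
    simp [i.isLt]
  have hcontr : ∀ q : ℕ, Ψ (((q + 1 : ℕ) : ℝ) * W.period) ≤ (∏ j, Θ j) * Ψ ((q : ℝ) * W.period) := by
    intro q
    have hk1 : k₀ - 1 + 1 = k₀ := Nat.sub_add_cancel W.pos
    have h := hchain q (k₀ - 1) (Nat.sub_lt W.pos one_pos)
    have hend' : (q : ℝ) * W.period + W.start ⟨k₀ - 1, Nat.sub_lt W.pos one_pos⟩ +
        (W.phase ⟨k₀ - 1, Nat.sub_lt W.pos one_pos⟩).τ = (((q + 1 : ℕ) : ℝ)) * W.period := by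
      have hPsum := period_eq_sum_range W
      have e : Finset.range k₀ = Finset.range (k₀ - 1 + 1) := by rw [hk1]
      rw [e, Finset.sum_range_succ, dif_pos (Nat.sub_lt W.pos one_pos), ← start_eq_sum_range W (k₀ - 1) (Nat.sub_lt W.pos one_pos)] at hPsum
      push_cast
      rw [add_mul, one_mul, hPsum]
      ring
    rw [hk1, hprod] at h
    rw [← hend']
    exact (hΦend q).trans h
  -- the energy is non-increasing
  have hmono : ∀ s τ, 0 ≤ s → s ≤ τ → E τ ≤ E s := fun s τ hs0 hsτ => by
    rw [hE]; exact totalEnergy_antitone W hn hκ.le ℓ hw₀ hdiv hmean hsupp N hs0 hsτ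
  have hmain := dominated_periodic_decay (E := E) (Ψ := Ψ) hP hΘ0 hΘ1 hβ0 (hEnn 0) hmono (fun q => hEΨ _) hΨ0 hcontr ht
  rw [hE] at hmain
  exact hmain

end Summit.AnomalousDissipation.AnomalousDissipation.Theorems.SolenoidalFractalHomogenisation.RealisedQuasiStaticCellLaw

end
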